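import Summits.QuantumFields.YangMills.Theorems.F4SubCurvatureDoorBigOBudgetSharpnessWitness
import Mathlib
import HarnessLib

/-!
# «BIG-O BUDGET SHARPNESS» for crux ⟨stmt-QuantumFields-23035⟩ — reflection positivity of the witness, part 1:
# the sextic `3h₆/‖x‖¹⁴` as (minus) the sum of the sixth derivatives of `1/‖x‖²` along the 24 minimal vectors of `D₄`

Free-hands work of width seat `ym-line-sfw-p2-w4` (g24, cell `ym-idea-1`) on the owner's NEGATIVE TARGET
`Cruxes/ShortRootRigidity/BigOBudgetSharpnessTarget.lean` (ym-idea-3 g21), last open clause `WitnessReflectionPositive`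
(w3 g37 landed the other six: `…BigOBudgetSharpnessWitness`, `…BigOBudgetSharpnessSymmetry`).

THE POSITION-SPACE HALF (pure one-variable calculus + algebra, Mathlib only):

* `iteratedDeriv_six_inv_quadratic` — for `A ≠ 0`,
  `(d/du)⁶ (A + 2Bu + Cu²)⁻¹ |_{u=0} = (46080B⁶ − 57600AB⁴C + 17280A²B²C² − 720A³C³)/A⁷`
  (Leibniz rule `iteratedDeriv_mul` on `(A+2Bu+Cu²)⁻¹ · (A+2Bu+Cu²) = 1`: the three-term recursion
  `A dₙ + 2nB dₙ₋₁ + n(n−1)C dₙ₋₂ = 0`; the value is `720 · A⁻⁴ C³ · U₆(−B/√(AC))·…`, Chebyshev's `U₆ = 64u⁶−80u⁴+24u²−1`);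
* `iteratedDeriv_six_inv_norm_add_smul_sq` — hence `(d/ds)⁶ ‖x + s v‖⁻² |₀` for `x ≠ 0` in `ℝ⁴`, with `A = ‖x‖²`, `B = ⟪x,v⟫`, `C = ‖v‖²`;
* `sum_roots_iteratedDeriv_six` — ★ summed over the 24 minimal vectors `v = ±eᵢ ± eⱼ` (`‖v‖² = 2`, `Σ⟪v,x⟫² = 12‖x‖²`,
  `Σ⟪v,x⟫⁴ = 12‖x‖⁴`, `Σ⟪v,x⟫⁶ = rootSextic x`):  `Σ_v (d/ds)⁶ ‖x + s v‖⁻² |₀ = −46080 · bigOWitness x`.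
  This is Hobson's formula `h(∂)(‖x‖⁻²) = 2⁶·6!·h(x)/‖x‖¹⁴` for the harmonic sextic `3h₆ = 15‖x‖⁶ − Σ_v⟪v,x⟫⁶`, written with
  `Δ³(‖x‖⁻²) = 0` so that only REAL directional derivatives along the roots remain.

Part 2 (Laplace–Fourier side: `‖x + sv‖⁻² = π ∫_{ℝ³} e^{−2π(t+sv₀)|w|}|w|⁻¹e^{−2πi⟪w, z⃗+s v⃗⟫} dw` from the tree's Yukawa transform,
differentiated six times under the integral) and the assembly of `WitnessReflectionPositive` are separate files.
HONEST LABEL: sharpness bookkeeping about the HYPOTHESES of an OPEN crux; nothing of ⟨23035⟩, R2d or the Yang–Mills mass gap is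
proved by this; `--supports stmt-QuantumFields-23035`.
-/

set_option autoImplicit false

noncomputable section

namespace Summit.QuantumFields.YangMills.Cruxes.ShortRootRigidity.Sharpness

open scoped BigOperators Topology RealInnerProductSpace
open Filter Set

/-! ## §1 The reciprocal quadratic `u ↦ (A + 2Bu + Cu²)⁻¹` -/

section Quadratic

variable (A B C : ℝ)

/-- `(A + 2Bu + Cu²)' = 2B + 2Cu`. [folklore] -/
theorem hasDerivAt_quadratic (u : ℝ) :
    HasDerivAt (fun u : ℝ => A + 2 * B * u + C * u ^ 2) (2 * B + 2 * C * u) u := by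
  have h1 : HasDerivAt (fun u : ℝ => 2 * B * u) (2 * B * 1) u := (hasDerivAt_id u).const_mul (2 * B)
  have h2 : HasDerivAt (fun u : ℝ => C * u ^ 2) (C * (2 * u)) u := by
    simpa using (hasDerivAt_pow 2 u).const_mul C
  exact (((hasDerivAt_const u A).add h1).add h2).congr_deriv (by ring)

/-- `deriv (A + 2Bu + Cu²) = 2B + 2Cu`. [folklore] -/
theorem deriv_quadratic : deriv (fun u : ℝ => A + 2 * B * u + C * u ^ 2) = fun u => 2 * B + 2 * C * u :=
  funext fun u => (hasDerivAt_quadratic A B C u).deriv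

/-- `deriv (2B + 2Cu) = 2C`. [folklore] -/
theorem deriv_linear : deriv (fun u : ℝ => 2 * B + 2 * C * u) = fun _ => 2 * C := by
  funext u
  have h : HasDerivAt (fun u : ℝ => 2 * B + 2 * C * u) (0 + 2 * C * 1) u :=
    (hasDerivAt_const u (2 * B)).add ((hasDerivAt_id u).const_mul (2 * C))
  rw [h.deriv]
  ring

/-- The iterated derivatives of the quadratic: `Q, 2B + 2Cu, 2C, 0, 0, …`. [folklore] -/
theorem iteratedDeriv_quadratic (n : ℕ) (u : ℝ) :
    iteratedDeriv n (fun u : ℝ => A + 2 * B * u + C * u ^ 2) u =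
      if n = 0 then A + 2 * B * u + C * u ^ 2 else if n = 1 then 2 * B + 2 * C * u else if n = 2 then 2 * C else 0 := by
  match n with
  | 0 => simp
  | 1 => simp [deriv_quadratic]
  | 2 =>
    rw [iteratedDeriv_succ, iteratedDeriv_one, deriv_quadratic, deriv_linear]
    simp
  | n + 3 =>
    rw [iteratedDeriv_succ', iteratedDeriv_succ', iteratedDeriv_succ', deriv_quadratic, deriv_linear]
    simp

/-- The quadratic is smooth. [folklore] -/
theorem contDiff_quadratic (n : WithTop ℕ∞) : ContDiff ℝ n (fun u : ℝ => A + 2 * B * u + C * u ^ 2) := by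
  fun_prop

variable {A}

/-- The reciprocal quadratic is smooth at `0` when `A ≠ 0`. [folklore] -/
theorem contDiffAt_inv_quadratic (hA : A ≠ 0) (n : WithTop ℕ∞) :
    ContDiffAt ℝ n (fun u : ℝ => (A + 2 * B * u + C * u ^ 2)⁻¹) 0 := by
  refine ((contDiff_quadratic A B C n).contDiffAt).inv ?_
  simpa using hA

/-- **Leibniz recursion** for `dₙ = (d/du)ⁿ (A + 2Bu + Cu²)⁻¹ |₀`:
`Σ_{i ≤ n} C(n,i) dᵢ Q⁽ⁿ⁻ⁱ⁾(0) = 0` for `n ≥ 1`, i.e. `A dₙ + 2nB dₙ₋₁ + n(n−1)C dₙ₋₂ = 0`. [folklore] -/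
theorem leibniz_inv_quadratic (hA : A ≠ 0) (n : ℕ) (hn : n ≠ 0) :
    ∑ i ∈ Finset.range (n + 1), (n.choose i : ℝ) *
        iteratedDeriv i (fun u : ℝ => (A + 2 * B * u + C * u ^ 2)⁻¹) 0 *
        iteratedDeriv (n - i) (fun u : ℝ => A + 2 * B * u + C * u ^ 2) 0 = 0 := by
  rw [← iteratedDeriv_mul (contDiffAt_inv_quadratic B C hA n) ((contDiff_quadratic A B C n).contDiffAt)]
  have hev : ((fun u : ℝ => (A + 2 * B * u + C * u ^ 2)⁻¹) * fun u : ℝ => A + 2 * B * u + C * u ^ 2) =ᶠ[𝓝 0]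
      fun _ => (1 : ℝ) := by
    have hc : ContinuousAt (fun u : ℝ => A + 2 * B * u + C * u ^ 2) 0 :=
      ((contDiff_quadratic A B C 0).continuous).continuousAt
    have hne : ∀ᶠ u in 𝓝 (0 : ℝ), A + 2 * B * u + C * u ^ 2 ≠ 0 :=
      hc.eventually_ne (by simpa using hA)
    filter_upwards [hne] with u hu
    simp only [Pi.mul_apply]
    exact inv_mul_cancel₀ hu
  rw [hev.iteratedDeriv_eq, iteratedDeriv_const]
  simp [hn]

/-- ★ **Sixth derivative of the reciprocal quadratic at `0`** (`A ≠ 0`):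
`(d/du)⁶ (A + 2Bu + Cu²)⁻¹ |₀ = (46080B⁶ − 57600AB⁴C + 17280A²B²C² − 720A³C³)/A⁷`. [folklore] -/
theorem iteratedDeriv_six_inv_quadratic (hA : A ≠ 0) :
    iteratedDeriv 6 (fun u : ℝ => (A + 2 * B * u + C * u ^ 2)⁻¹) 0 =
      (46080 * B ^ 6 - 57600 * A * B ^ 4 * C + 17280 * A ^ 2 * B ^ 2 * C ^ 2 - 720 * A ^ 3 * C ^ 3) / A ^ 7 := by
  have R1 := leibniz_inv_quadratic B C hA 1 (by norm_num)
  have R2 := leibniz_inv_quadratic B C hA 2 (by norm_num)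
  have R3 := leibniz_inv_quadratic B C hA 3 (by norm_num)
  have R4 := leibniz_inv_quadratic B C hA 4 (by norm_num)
  have R5 := leibniz_inv_quadratic B C hA 5 (by norm_num)
  have R6 := leibniz_inv_quadratic B C hA 6 (by norm_num)
  simp only [Finset.sum_range_succ, Finset.sum_range_zero, iteratedDeriv_quadratic, Nat.choose, iteratedDeriv_zero,
    iteratedDeriv_one] at R1 R2 R3 R4 R5 R6
  norm_num at R1 R2 R3 R4 R5 R6
  rw [iteratedDeriv_succ, iteratedDeriv_one] at R2
  set d1 := deriv (fun u : ℝ => (A + 2 * B * u + C * u ^ 2)⁻¹) 0 with hd1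
  set d2 := iteratedDeriv 2 (fun u : ℝ => (A + 2 * B * u + C * u ^ 2)⁻¹) 0 with hd2
  set d3 := iteratedDeriv 3 (fun u : ℝ => (A + 2 * B * u + C * u ^ 2)⁻¹) 0 with hd3
  set d4 := iteratedDeriv 4 (fun u : ℝ => (A + 2 * B * u + C * u ^ 2)⁻¹) 0 with hd4
  set d5 := iteratedDeriv 5 (fun u : ℝ => (A + 2 * B * u + C * u ^ 2)⁻¹) 0 with hd5
  set d6 := iteratedDeriv 6 (fun u : ℝ => (A + 2 * B * u + C * u ^ 2)⁻¹) 0 with hd6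
  have hd2' : deriv (deriv fun u : ℝ => (A + 2 * B * u + C * u ^ 2)⁻¹) 0 = d2 := by
    rw [hd2, iteratedDeriv_succ, iteratedDeriv_one]
  rw [hd2'] at R2
  have hd0 : A * A⁻¹ = 1 := mul_inv_cancel₀ hA
  have E1 : A ^ 2 * d1 = -2 * B := by linear_combination A * R1 - 2 * B * hd0
  have E2 : A ^ 3 * d2 = 8 * B ^ 2 - 2 * A * C := by
    linear_combination A ^ 2 * R2 - 4 * B * E1 - 2 * C * A * hd0
  have E3 : A ^ 4 * d3 = -48 * B ^ 3 + 24 * A * B * C := by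
    linear_combination A ^ 3 * R3 - 6 * B * E2 - 6 * C * A * E1
  have E4 : A ^ 5 * d4 = 384 * B ^ 4 - 288 * A * B ^ 2 * C + 24 * A ^ 2 * C ^ 2 := by
    linear_combination A ^ 4 * R4 - 8 * B * E3 - 12 * C * A * E2
  have E5 : A ^ 6 * d5 = -3840 * B ^ 5 + 3840 * A * B ^ 3 * C - 720 * A ^ 2 * B * C ^ 2 := by
    linear_combination A ^ 5 * R5 - 10 * B * E4 - 20 * C * A * E3
  have E6 : A ^ 7 * d6 = 46080 * B ^ 6 - 57600 * A * B ^ 4 * C + 17280 * A ^ 2 * B ^ 2 * C ^ 2 - 720 * A ^ 3 * C ^ 3 := by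
    linear_combination A ^ 6 * R6 - 12 * B * E5 - 30 * C * A * E4
  have hA7 : A ^ 7 ≠ 0 := pow_ne_zero 7 hA
  field_simp
  linear_combination E6

end Quadratic

/-! ## §2 The sixth derivative of `s ↦ ‖x + s v‖⁻²` at `0` -/

/-- `‖x + s v‖² = ‖x‖² + 2⟪x,v⟫ s + ‖v‖² s²`. [folklore] -/
theorem norm_add_smul_sq (x v : E4) (s : ℝ) : ‖x + s • v‖ ^ 2 = ‖x‖ ^ 2 + 2 * ⟪x, v⟫ * s + ‖v‖ ^ 2 * s ^ 2 := by
  rw [norm_add_sq_real, real_inner_smul_right, norm_smul, mul_pow, Real.norm_eq_abs, sq_abs]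
  ring

/-- **`(d/ds)⁶ ‖x + s v‖⁻² |₀`** for `x ≠ 0`: the reciprocal-quadratic formula with `A = ‖x‖²`, `B = ⟪x,v⟫`, `C = ‖v‖²`. [folklore] -/
theorem iteratedDeriv_six_inv_norm_add_smul_sq (x v : E4) (hx : x ≠ 0) :
    iteratedDeriv 6 (fun s : ℝ => (‖x + s • v‖ ^ 2)⁻¹) 0 =
      (46080 * ⟪x, v⟫ ^ 6 - 57600 * ‖x‖ ^ 2 * ⟪x, v⟫ ^ 4 * ‖v‖ ^ 2 + 17280 * (‖x‖ ^ 2) ^ 2 * ⟪x, v⟫ ^ 2 * (‖v‖ ^ 2) ^ 2 -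
        720 * (‖x‖ ^ 2) ^ 3 * (‖v‖ ^ 2) ^ 3) / (‖x‖ ^ 2) ^ 7 := by
  have hfun : (fun s : ℝ => (‖x + s • v‖ ^ 2)⁻¹) = fun s : ℝ => (‖x‖ ^ 2 + 2 * ⟪x, v⟫ * s + ‖v‖ ^ 2 * s ^ 2)⁻¹ := by
    funext s; rw [norm_add_smul_sq]
  rw [hfun]
  exact iteratedDeriv_six_inv_quadratic ⟪x, v⟫ (‖v‖ ^ 2) (pow_ne_zero 2 (norm_ne_zero_iff.2 hx))

/-! ## §3 Summing over the 24 minimal vectors of `D₄` -/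

/-- Coordinates of the minimal vectors: `(±eᵢ ± eⱼ) k`. [folklore] -/
theorem rootVec_apply (i j : Fin 4) (a b : Bool) (k : Fin 4) :
    rootVec i j a b k = (if a then (1 : ℝ) else -1) * (if k = i then 1 else 0) + (if b then (1 : ℝ) else -1) * (if k = j then 1 else 0) := by
  cases a <;> cases b <;> simp [rootVec, e, PiLp.single_apply] <;> split_ifs <;> norm_num

/-- The minimal vectors have squared norm `2` (`i ≠ j`). [folklore] -/
theorem norm_sq_rootVec {i j : Fin 4} (hij : i < j) (a b : Bool) : ‖rootVec i j a b‖ ^ 2 = 2 := by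
  have hne : i ≠ j := hij.ne
  have hne' : j ≠ i := hij.ne'
  rw [← real_inner_self_eq_norm_sq, inner_rootVec, rootVec_apply, rootVec_apply]
  cases a <;> cases b <;> simp [hne, hne'] <;> norm_num

/-- ★ **Hobson's formula along the roots**: for `x ≠ 0`,
`Σ_{v = ±eᵢ±eⱼ} (d/ds)⁶ ‖x + s v‖⁻² |₀ = −46080 · K(x)`, `K = bigOWitness = 3h₆/‖x‖¹⁴`. [folklore] -/
theorem sum_roots_iteratedDeriv_six (x : E4) (hx : x ≠ 0) :
    (∑ i : Fin 4, ∑ j : Fin 4, if i < j then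
      iteratedDeriv 6 (fun s : ℝ => (‖x + s • rootVec i j true true‖ ^ 2)⁻¹) 0 +
      iteratedDeriv 6 (fun s : ℝ => (‖x + s • rootVec i j true false‖ ^ 2)⁻¹) 0 +
      iteratedDeriv 6 (fun s : ℝ => (‖x + s • rootVec i j false true‖ ^ 2)⁻¹) 0 +
      iteratedDeriv 6 (fun s : ℝ => (‖x + s • rootVec i j false false‖ ^ 2)⁻¹) 0
      else 0) = -46080 * bigOWitness x := by
  have hA : ‖x‖ ^ 2 ≠ 0 := pow_ne_zero 2 (norm_ne_zero_iff.2 hx)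
  have h14 : ‖x‖ ^ 14 = (‖x‖ ^ 2) ^ 7 := by ring
  simp only [iteratedDeriv_six_inv_norm_add_smul_sq x _ hx]
  have hterm : ∀ (i j : Fin 4), i < j → ∀ (a b : Bool),
      (46080 * ⟪x, rootVec i j a b⟫ ^ 6 - 57600 * ‖x‖ ^ 2 * ⟪x, rootVec i j a b⟫ ^ 4 * ‖rootVec i j a b‖ ^ 2 +
          17280 * (‖x‖ ^ 2) ^ 2 * ⟪x, rootVec i j a b⟫ ^ 2 * (‖rootVec i j a b‖ ^ 2) ^ 2 -
          720 * (‖x‖ ^ 2) ^ 3 * (‖rootVec i j a b‖ ^ 2) ^ 3) / (‖x‖ ^ 2) ^ 7 =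
        (46080 * (inner ℝ (rootVec i j a b) x) ^ 6 - 115200 * ‖x‖ ^ 2 * (inner ℝ (rootVec i j a b) x) ^ 4 +
          69120 * (‖x‖ ^ 2) ^ 2 * (inner ℝ (rootVec i j a b) x) ^ 2 - 5760 * (‖x‖ ^ 2) ^ 3) / (‖x‖ ^ 2) ^ 7 := by
    intro i j hij a b
    rw [norm_sq_rootVec hij, real_inner_comm]
    ring
  have hsum : ∀ (i j : Fin 4), (if i < j then
      (46080 * ⟪x, rootVec i j true true⟫ ^ 6 - 57600 * ‖x‖ ^ 2 * ⟪x, rootVec i j true true⟫ ^ 4 * ‖rootVec i j true true‖ ^ 2 +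
          17280 * (‖x‖ ^ 2) ^ 2 * ⟪x, rootVec i j true true⟫ ^ 2 * (‖rootVec i j true true‖ ^ 2) ^ 2 -
          720 * (‖x‖ ^ 2) ^ 3 * (‖rootVec i j true true‖ ^ 2) ^ 3) / (‖x‖ ^ 2) ^ 7 +
      (46080 * ⟪x, rootVec i j true false⟫ ^ 6 - 57600 * ‖x‖ ^ 2 * ⟪x, rootVec i j true false⟫ ^ 4 * ‖rootVec i j true false‖ ^ 2 +
          17280 * (‖x‖ ^ 2) ^ 2 * ⟪x, rootVec i j true false⟫ ^ 2 * (‖rootVec i j true false‖ ^ 2) ^ 2 -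
          720 * (‖x‖ ^ 2) ^ 3 * (‖rootVec i j true false‖ ^ 2) ^ 3) / (‖x‖ ^ 2) ^ 7 +
      (46080 * ⟪x, rootVec i j false true⟫ ^ 6 - 57600 * ‖x‖ ^ 2 * ⟪x, rootVec i j false true⟫ ^ 4 * ‖rootVec i j false true‖ ^ 2 +
          17280 * (‖x‖ ^ 2) ^ 2 * ⟪x, rootVec i j false true⟫ ^ 2 * (‖rootVec i j false true‖ ^ 2) ^ 2 -
          720 * (‖x‖ ^ 2) ^ 3 * (‖rootVec i j false true‖ ^ 2) ^ 3) / (‖x‖ ^ 2) ^ 7 +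
      (46080 * ⟪x, rootVec i j false false⟫ ^ 6 - 57600 * ‖x‖ ^ 2 * ⟪x, rootVec i j false false⟫ ^ 4 * ‖rootVec i j false false‖ ^ 2 +
          17280 * (‖x‖ ^ 2) ^ 2 * ⟪x, rootVec i j false false⟫ ^ 2 * (‖rootVec i j false false‖ ^ 2) ^ 2 -
          720 * (‖x‖ ^ 2) ^ 3 * (‖rootVec i j false false‖ ^ 2) ^ 3) / (‖x‖ ^ 2) ^ 7
      else 0) =
      if i < j then
        ((46080 * (inner ℝ (rootVec i j true true) x) ^ 6 - 115200 * ‖x‖ ^ 2 * (inner ℝ (rootVec i j true true) x) ^ 4 +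
          69120 * (‖x‖ ^ 2) ^ 2 * (inner ℝ (rootVec i j true true) x) ^ 2 - 5760 * (‖x‖ ^ 2) ^ 3) / (‖x‖ ^ 2) ^ 7 +
        (46080 * (inner ℝ (rootVec i j true false) x) ^ 6 - 115200 * ‖x‖ ^ 2 * (inner ℝ (rootVec i j true false) x) ^ 4 +
          69120 * (‖x‖ ^ 2) ^ 2 * (inner ℝ (rootVec i j true false) x) ^ 2 - 5760 * (‖x‖ ^ 2) ^ 3) / (‖x‖ ^ 2) ^ 7 +
        (46080 * (inner ℝ (rootVec i j false true) x) ^ 6 - 115200 * ‖x‖ ^ 2 * (inner ℝ (rootVec i j false true) x) ^ 4 +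
          69120 * (‖x‖ ^ 2) ^ 2 * (inner ℝ (rootVec i j false true) x) ^ 2 - 5760 * (‖x‖ ^ 2) ^ 3) / (‖x‖ ^ 2) ^ 7 +
        (46080 * (inner ℝ (rootVec i j false false) x) ^ 6 - 115200 * ‖x‖ ^ 2 * (inner ℝ (rootVec i j false false) x) ^ 4 +
          69120 * (‖x‖ ^ 2) ^ 2 * (inner ℝ (rootVec i j false false) x) ^ 2 - 5760 * (‖x‖ ^ 2) ^ 3) / (‖x‖ ^ 2) ^ 7)
      else 0 := by
    intro i j
    split_ifs with hij
    · rw [hterm i j hij, hterm i j hij, hterm i j hij, hterm i j hij]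
    · rfl
  simp only [hsum]
  rw [bigOWitness, h14, h6three_expand, rootSextic_expand]
  simp only [inner_rootVec, Fin.sum_univ_four, Fin.isValue, Fin.reduceLT, if_true, if_false, Bool.false_eq_true]
  rw [norm_sq_E4]
  have hA' : x 0 ^ 2 + x 1 ^ 2 + x 2 ^ 2 + x 3 ^ 2 ≠ 0 := by rwa [← norm_sq_E4]
  field_simp
  ring

end Summit.QuantumFields.YangMills.Cruxes.ShortRootRigidity.Sharpness

end
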